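import Literature.NumberTheory.EllipticCurves.KubertTateSevenMuDescent
import HarnessLib

/-!
# The `μ₇`-descent on the Kubert–Tate `7`-torsion family, II: the Kummer homomorphism on rational points and
# the box-filling criterion `7 ^ ω(mn(m−n)) ≤ #(E(ℚ)/7E(ℚ))` from `ω(mn(m−n))` points and a determinant mod `7`

PROOF-ONLY file (theorems only; no definition, no named fact, no `sorry`), topic
`NumberTheory/EllipticCurves`; sequel of `KubertTateSevenMuDescent` (the `7`-torsion sibling of `KubertTateFiveMuDescentBox`, followed declaration by declaration). Setting as there: `E = E_{m,n}`
(`kubertTateSeven m n` over `ℚ`, elliptic), `φ` Vélu, `ψ` a dual (`ψ ∘ φ = [7]`), `T = (0,0)`, a reference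
point `P₁ ∈ E(ℚ̄)^Γ` with `49 P₁ ≠ O`, `f_T = x²y − n(m+n)x³ + n³(2m+n)xy − m²n⁴x² + m²n⁶y`, `S` = the prime factors of `mn(m − n)`.

* `kummerValue_ne_zero` — `f_T(x, y) ≠ 0` at a rational affine point `(x, y) ≠ T` of `E`.
* `exists_kummerHom` — **the Kummer homomorphism `κ : E(ℚ) → H¹(ℚ, E'[ψ])`**, `P ↦ [σ ↦ σQ − Q]`
  (`ψ Q = P`; tree `Isogeny.exists_kummerCocycle`, `kummerClass_add`, `kummerClass_eq_of_apply_eq`),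
  killing `7E(ℚ) = ψ(φ(E(ℚ)))`.
* `exists_valHom` — **the valuation homomorphism `Φ : E(ℚ) → (ℤ/7)^S`**, `Φ(P) = (v_q mod 7)_{q ∈ S}` of
  the Kummer invariant of `κ(P)` in `ℚˣ/ℚˣ⁷` (`kummerInvariant`), with `Φ(7R) = 0` and, for rational affine
  points `P, P' ≠ T`, **`Φ(P) − Φ(P') = (v_q f_T(P) − v_q f_T(P'))_q`** (the Kummer invariant is the descent
  value, `IsogenyDualKernelKummerDescent.exists_mul_pow_eq_value_of_coboundary`).
* **`pow_card_le_natCard_quotient_of_span`** — if rational affine points `P_i ≠ T` (`i ∈ ι`) and a base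
  point `P' ≠ T` (e.g. `P' = 2T = (m²n(m−n), m³n(m−n)²)`, `f_T(2T) = m⁶n³(m−n)⁵`) have difference vectors
  `(v_q f_T(P_i) − v_q f_T(P'))_{q ∈ S} mod 7` SPANNING `(ℤ/7)^S`, then `7 ^ #S ≤ #(E(ℚ)/7E(ℚ))` — the box of
  `KubertTateSevenMuDescent` §4 is full; hence (tame régime) **`shaCorank_seven_eq_zero_of_span :
  t₇(E_{m,n}) = 0`**, `sha_torsionBy_seven_eq_bot_of_span : Ш(E_{m,n}/ℚ)[7] = 0` and
  `mordellWeilRank_succ_eq_of_span : rank E_{m,n}(ℚ) + 1 = ω(mn(m−n))`. An instance thus costs: the tame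
  check, `ω(mn(m−n))` explicit points with their `f_T`-values factorised, one point with `49P ≠ O`, and a
  determinant mod `7`.
* §4 `shaCorank_seven_eq_zero_of_matrix`, `sha_torsionBy_seven_eq_bot_of_matrix`,
  `primaryComponent_sha_seven_eq_bot_of_matrix`, `mordellWeilRank_succ_eq_of_matrix` — the same with the
  spanning hypothesis replaced by a left-inverse matrix mod `7` (`pow_card_le_natCard_quotient_of_matrix`),
  the shape an instance file applies verbatim.
* §5 CLASS-WIDE: `shaCorank_seven_eq_zero_of_le_mordellWeilRank_succ` — in the tame régime (and given
  `#E(ℚ)[7] = 7`), **`t₇(E_{m,n}) = 0` whenever `rank E_{m,n}(ℚ) + 1 ≥ ω(mn(m−n))`** (the rank decides the box: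
  `mordellWeilRank_succ_eq_iff`); `sha_torsionBy_seven_eq_bot_of_le_mordellWeilRank_succ`; and the first-descent
  bound **`natCard_sha_torsionBy_seven_mul_pow_le : #Ш(E_{m,n}/ℚ)[7] · 7^{rank+1} ≤ 7^{ω(mn(m−n))}`** (with Cassels–Tate:
  `rank + t₇ + 1 ≤ ω(mn(m−n))` on the whole tame family).

## References

* [SilvermanAEC2009] J. H. Silverman, *AEC*, 2nd ed., X.§4 Prop. 4.1 and sequence (*), Thm. X.4.2, Prop. X.4.9,
  Exercise 10.1(c), Thm. X.1.1.
* [Fisher2001FiveSevenDescent] T. Fisher, JEMS 3 (2001), §§1–2.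
* [Kubert1976] D. S. Kubert, *Universal bounds on the torsion of elliptic curves*, Table 3 (`N = 7`).
-/

noncomputable section

open scoped Classical NNReal NumberField AddSubgroup
open WeierstrassCurve WeierstrassCurve.Isogeny Field IsDedekindDomain
open Literature.NumberTheory.EllipticCurves Literature.NumberTheory.EllipticCurves.KubertTateSevenKummer
  Literature.NumberTheory.EllipticCurves.KubertTateSevenVelu Literature.NumberTheory.GaloisRepresentations
  Literature.NumberTheory.EllipticCurves.WeierstrassFunctionField

-- The `ℚ`-algebra diamond: same device as `KubertTateSevenMuDescent`.
attribute [-instance] DivisionRing.toRatAlgebra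

namespace Literature.NumberTheory.EllipticCurves

namespace KubertTateSevenMuDescent

variable (m n : ℤ) [hE : (kubertTateSeven (m : ℚ) (n : ℚ)).IsElliptic]
variable (ψ : Isogeny (kubertTateSeven' (m : ℚ) (n : ℚ)) (kubertTateSeven (m : ℚ) (n : ℚ)))
  (hψ : ∀ P, ψ (sevenIsogeny (m : ℚ) (n : ℚ) P) = ((7 : ℕ) : ℤ) • P)
variable (P₁ : geomPoints (kubertTateSeven (m : ℚ) (n : ℚ)))
  (hP₁ : ∀ σ : absoluteGaloisGroup ℚ, σ • P₁ = P₁) (h49 : ((49 : ℕ) : ℤ) • P₁ ≠ 0)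

/-! ## §1 Values of `f_T` at rational points are non-zero -/

/-- **`f_T(x, y) = x²y − n(m+n)x³ + n³(2m+n)xy − m²n⁴x² + m²n⁶y ≠ 0` at a rational affine point `(x, y) ≠ T` of
`E_{m,n}`** (read in `ℚ_q` for a prime `q ∤ mn(m − n)`, where `v_q f_T(x,y) ∈ 7ℤ` by
`valuation_kummerFn_eq_seven_mul`). [cite: SilvermanAEC2009, Exercise 10.1(c)] -/
theorem kummerValue_ne_zero {x y : ℚ}
    (he : y ^ 2 + ((n : ℚ) ^ 2 + m * n - m ^ 2) * x * y + m ^ 2 * (n : ℚ) ^ 3 * (n - m) * y =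
      x ^ 3 + m ^ 2 * n * (n - m) * x ^ 2) (hT : ¬ (x = 0 ∧ y = 0)) :
    x ^ 2 * y - n * (m + n) * x ^ 3 + (n : ℚ) ^ 3 * (2 * m + n) * x * y - m ^ 2 * (n : ℚ) ^ 4 * x ^ 2
      + m ^ 2 * (n : ℚ) ^ 6 * y ≠ 0 := by
  obtain ⟨hm0, hn0, hmn0, -⟩ := ne_zero_of_isElliptic (m : ℚ) (n : ℚ)
  have hm0' : m ≠ 0 := by exact_mod_cast hm0
  have hn0' : n ≠ 0 := by exact_mod_cast hn0
  have hmn0' : m - n ≠ 0 := by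
    intro h; apply hmn0; exact_mod_cast (sub_eq_zero.mp h)
  -- a prime `q > |mn(m-n)|` divides neither `m` nor `n` nor `m - n`
  obtain ⟨q, hqgt, hq⟩ := Nat.exists_infinite_primes ((m * n * (m - n)).natAbs + 1)
  haveI : Fact q.Prime := ⟨hq⟩
  have hqmn : ¬ (q : ℤ) ∣ m * n * (m - n) := by
    intro hd
    have hd' : q ∣ (m * n * (m - n)).natAbs := by simpa using Int.natAbs_dvd_natAbs.mpr hd
    have hle : q ≤ (m * n * (m - n)).natAbs :=
      Nat.le_of_dvd (Int.natAbs_pos.mpr (mul_ne_zero (mul_ne_zero hm0' hn0') hmn0')) hd'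
    omega
  have hqm : ¬ (q : ℤ) ∣ m := fun hd ↦ hqmn ((hd.mul_right n).mul_right (m - n))
  have hqn : ¬ (q : ℤ) ∣ n := fun hd ↦ hqmn ((dvd_mul_of_dvd_right hd m).mul_right (m - n))
  have hqd : ¬ (q : ℤ) ∣ (m - n) := fun hd ↦ hqmn (dvd_mul_of_dvd_right hd (m * n))
  have he' : (y : ℚ_[q]) ^ 2 + ((n : ℚ_[q]) ^ 2 + m * n - m ^ 2) * x * y + m ^ 2 * (n : ℚ_[q]) ^ 3 * (n - m) * y =
      (x : ℚ_[q]) ^ 3 + m ^ 2 * n * (n - m) * (x : ℚ_[q]) ^ 2 := by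
    exact_mod_cast congrArg (fun r : ℚ ↦ (r : ℚ_[q])) he
  have hT' : ¬ ((x : ℚ_[q]) = 0 ∧ (y : ℚ_[q]) = 0) := by
    rintro ⟨hx, hy⟩; exact hT ⟨by exact_mod_cast hx, by exact_mod_cast hy⟩
  obtain ⟨hF0, -⟩ := valuation_kummerFn_eq_seven_mul m n q hqm hqn hqd he' hT'
  intro h0
  have h0' := congrArg (fun r : ℚ ↦ (r : ℚ_[q])) h0
  push_cast at h0'
  exact hF0 h0'

/-! ## §2 The Kummer homomorphism on rational points and its valuation vector -/

/-- `v_q mod 7` is well defined on `ℚˣ/ℚˣ⁷`. [folklore] -/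
private theorem padicValRat_cast_eq_of_mk_eq {a b : ℚˣ}
    (h : (QuotientGroup.mk a : ℚˣ ⧸ (powMonoidHom 7 : ℚˣ →* ℚˣ).range) = QuotientGroup.mk b)
    (q : ℕ) [Fact q.Prime] :
    ((padicValRat q (a : ℚ) : ℤ) : ZMod 7) = ((padicValRat q (b : ℚ) : ℤ) : ZMod 7) := by
  rw [QuotientGroup.eq] at h
  obtain ⟨w, hw⟩ := h
  have hbw : (b : ℚ) = a * (w : ℚ) ^ 7 := by
    have := congrArg (fun z : ℚˣ ↦ (z : ℚ)) hw
    simp only [powMonoidHom_apply, Units.val_mul, Units.val_pow_eq_pow_val, Units.val_inv_eq_inv_val] at this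
    field_simp at this
    linear_combination -this
  rw [hbw, padicValRat.mul a.ne_zero (pow_ne_zero _ w.ne_zero), padicValRat.pow]
  rw [ZMod.intCast_eq_intCast_iff_dvd_sub]
  exact ⟨padicValRat q (w : ℚ), by push_cast; ring⟩

section Hom

/- `E(ℚ)` with the classical `DecidableEq ℚ`, as in the generic isogeny library and in
`KubertTateSevenMuDescent` §4. -/
attribute [local instance 10000] Classical.propDecidable

include hψ in
/-- **The Kummer homomorphism `κ : E(ℚ) → H¹(ℚ, E'[ψ])`, `P ↦ [σ ↦ σQ − Q]` with `ψ Q = P`** (connecting map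
of the Kummer sequence of `ψ`; tree `Isogeny.exists_kummerCocycle`, `kummerClass_add`,
`kummerClass_eq_of_apply_eq`), which kills `7E(ℚ) = ψ(φ(E(ℚ)))`. [cite: SilvermanAEC2009, X.§4 Prop. 4.1 and sequence (*)] -/
theorem exists_kummerHom :
    letI := ψ.kerAction
    ∃ κ : (kubertTateSeven (m : ℚ) (n : ℚ)).toAffine.Point →+ ψ.galH1Ker,
      (∀ R, κ ((7 : ℕ) • R) = 0) ∧
      ∀ P, ∃ (c : contOneCocycles (discreteTopRep (absoluteGaloisGroup ℚ) ψ.toAddMonoidHom.ker))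
        (Q' : geomPoints (kubertTateSeven' (m : ℚ) (n : ℚ))),
        κ P = oneCocycleClass _ c ∧
        (∀ σ, ((c.1 σ : ψ.toAddMonoidHom.ker) : geomPoints (kubertTateSeven' (m : ℚ) (n : ℚ))) = σ • Q' - Q') ∧
        ψ Q' = toGeomPoints _ P := by
  letI := ψ.kerAction
  -- roots `ψ (root P) = ι P` and their Kummer cocycles
  choose root hroot using fun P : (kubertTateSeven (m : ℚ) (n : ℚ)).toAffine.Point ↦
    ψ.surjective (toGeomPoints _ P)
  have hfix : ∀ P (σ : absoluteGaloisGroup ℚ), σ • ψ (root P) = ψ (root P) := fun P σ ↦ by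
    rw [hroot, smul_toGeomPoints]
  choose coc hcoc using fun P ↦ ψ.exists_kummerCocycle (hfix P)
  -- additivity of the classes
  have hadd : ∀ P P', oneCocycleClass _ (coc (P + P')) = oneCocycleClass _ (coc P) + oneCocycleClass _ (coc P') := by
    intro P P'
    have hfix' : ∀ σ : absoluteGaloisGroup ℚ, σ • ψ (root P + root P') = ψ (root P + root P') := fun σ ↦ by
      rw [map_add, smul_add, hfix, hfix]
    obtain ⟨c'', hc''⟩ := ψ.exists_kummerCocycle hfix'
    rw [← ψ.kummerClass_add (coc P) (coc P') c'' (hcoc P) (hcoc P') hc'']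
    exact ψ.kummerClass_eq_of_apply_eq (coc (P + P')) c'' (hcoc (P + P')) hc''
      (by rw [hroot, map_add ψ (root P) (root P'), hroot, hroot, (toGeomPoints _).map_add])
  refine ⟨AddMonoidHom.mk' (fun P ↦ oneCocycleClass _ (coc P)) hadd, fun R ↦ ?_,
    fun P ↦ ⟨coc P, root P, rfl, hcoc P, hroot P⟩⟩
  -- `κ (7R) = 0`: the root may be taken to be `φ (ι R)`, a `Γ_ℚ`-fixed point
  have hQ : ψ (sevenIsogeny (m : ℚ) (n : ℚ) (toGeomPoints _ R)) = toGeomPoints _ ((7 : ℕ) • R) := by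
    rw [hψ, (toGeomPoints _).map_nsmul, natCast_zsmul]
  have hfixφ : ∀ σ : absoluteGaloisGroup ℚ, σ • ψ (sevenIsogeny (m : ℚ) (n : ℚ) (toGeomPoints _ R)) =
      ψ (sevenIsogeny (m : ℚ) (n : ℚ) (toGeomPoints _ R)) := fun σ ↦ by rw [hQ, smul_toGeomPoints]
  obtain ⟨c', hc'⟩ := ψ.exists_kummerCocycle hfixφ
  change oneCocycleClass _ (coc ((7 : ℕ) • R)) = 0
  rw [ψ.kummerClass_eq_of_apply_eq (coc _) c' (hcoc _) hc' (by rw [hroot, hQ]), ψ.kummerClass_eq_zero_iff c' hc']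
  exact ⟨0, AddSubgroup.zero_mem _, fun σ ↦ by rw [sub_zero, ← Isogeny.map_smul, smul_toGeomPoints]⟩

include hψ hP₁ h49 in
/-- **The valuation homomorphism `Φ : E(ℚ) → (ℤ/7)^S`** (`S` = prime factors of `mn(m − n)`): `Φ(P)` is the vector of
`q`-adic valuations mod `7` of the Kummer invariant of `κ(P)` in `ℚˣ/ℚˣ⁷`; it kills `7E(ℚ)`, and for rational
affine points `P = (x, y)`, `P' = (x', y')` off `T`, **`Φ(P) − Φ(P') = (v_q f_T(x,y) − v_q f_T(x',y'))_q`**: the Kummer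
invariant is the descent value `f_T(P)/f_T(7P₁)` (`IsogenyDualKernelKummerDescent.exists_mul_pow_eq_value_of_coboundary`).
[cite: SilvermanAEC2009, Exercise 10.1(c) and the proof of Thm. X.1.1(c)] [cite: Fisher2001FiveSevenDescent, §1] -/
theorem exists_valHom :
    ∃ Φ : (kubertTateSeven (m : ℚ) (n : ℚ)).toAffine.Point →+ (↥(m * n * (m - n)).natAbs.primeFactors → ZMod 7),
      (∀ R, Φ ((7 : ℕ) • R) = 0) ∧
      ∀ (x y : ℚ) (h : (kubertTateSeven (m : ℚ) (n : ℚ)).toAffine.Nonsingular x y) (_ : ¬ (x = 0 ∧ y = 0))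
        (x' y' : ℚ) (h' : (kubertTateSeven (m : ℚ) (n : ℚ)).toAffine.Nonsingular x' y') (_ : ¬ (x' = 0 ∧ y' = 0)),
        Φ (.some x y h) - Φ (.some x' y' h') = fun q : ↥(m * n * (m - n)).natAbs.primeFactors ↦
          ((padicValRat q (x ^ 2 * y - n * (m + n) * x ^ 3 + (n : ℚ) ^ 3 * (2 * m + n) * x * y - m ^ 2 * (n : ℚ) ^ 4 * x ^ 2 + m ^ 2 * (n : ℚ) ^ 6 * y) -
            padicValRat q (x' ^ 2 * y' - n * (m + n) * x' ^ 3 + (n : ℚ) ^ 3 * (2 * m + n) * x' * y' - m ^ 2 * (n : ℚ) ^ 4 * x' ^ 2 + m ^ 2 * (n : ℚ) ^ 6 * y') : ℤ) : ZMod 7) := by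
  letI := ψ.kerAction
  set T₀ := Tbar (m : ℚ) (n : ℚ) with hT₀
  have hT : ((7 : ℕ) : ℤ) • T₀ = 0 := seven_zsmul_Tbar (m : ℚ) (n : ℚ)
  have hT0 : T₀ ≠ 0 := Tbar_ne_zero (m : ℚ) (n : ℚ)
  have hTfix : ∀ σ : absoluteGaloisGroup ℚ, σ • T₀ = T₀ := smul_Tbar (m : ℚ) (n : ℚ)
  have hker : (sevenIsogeny (m : ℚ) (n : ℚ)).toAddMonoidHom.ker = AddSubgroup.zmultiples T₀ :=
    ker_sevenIsogeny_eq_zmultiples (m : ℚ) (n : ℚ)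
  obtain ⟨κ, hκ7, hκ⟩ := exists_kummerHom m n ψ hψ
  set Κ := kummerInvariant (sevenIsogeny (m : ℚ) (n : ℚ)) ψ hψ T₀ hT hTfix hker with hΚ
  -- representatives of classes in `ℚˣ/ℚˣ⁷`
  have hrep : ∀ z : Additive (ℚˣ ⧸ (powMonoidHom 7 : ℚˣ →* ℚˣ).range), ∃ a : ℚˣ,
      z = Additive.ofMul (QuotientGroup.mk a) := fun z ↦ by
    obtain ⟨a, ha⟩ := QuotientGroup.mk_surjective (Additive.toMul z)
    exact ⟨a, by rw [ha]; rfl⟩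
  choose rep hrep using hrep
  -- `Φ P = (v_q (rep (Κ (κ P))) mod 7)_q`, additive
  have hΦadd : ∀ P P', (fun q : ↥(m * n * (m - n)).natAbs.primeFactors ↦ ((padicValRat q (rep (Κ (κ (P + P'))) : ℚ) : ℤ) : ZMod 7)) =
      (fun q : ↥(m * n * (m - n)).natAbs.primeFactors ↦ ((padicValRat q (rep (Κ (κ P)) : ℚ) : ℤ) : ZMod 7)) +
      (fun q : ↥(m * n * (m - n)).natAbs.primeFactors ↦ ((padicValRat q (rep (Κ (κ P')) : ℚ) : ℤ) : ZMod 7)) := by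
    intro P P'
    have hmk : (QuotientGroup.mk (rep (Κ (κ (P + P')))) : ℚˣ ⧸ (powMonoidHom 7 : ℚˣ →* ℚˣ).range) =
        QuotientGroup.mk (rep (Κ (κ P)) * rep (Κ (κ P'))) := by
      apply Additive.ofMul.injective
      rw [QuotientGroup.mk_mul, ofMul_mul, ← hrep, ← hrep, ← hrep, map_add, map_add]
    ext q
    haveI : Fact (q : ℕ).Prime := ⟨Nat.prime_of_mem_primeFactors q.2⟩
    rw [Pi.add_apply, padicValRat_cast_eq_of_mk_eq hmk q, Units.val_mul,
      padicValRat.mul (rep _).ne_zero (rep _).ne_zero, Int.cast_add]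
  refine ⟨AddMonoidHom.mk' (fun P ↦ fun q : ↥(m * n * (m - n)).natAbs.primeFactors ↦
      ((padicValRat q (rep (Κ (κ P)) : ℚ) : ℤ) : ZMod 7)) hΦadd, fun R ↦ ?_, fun x y h hxy x' y' h' hxy' ↦ ?_⟩
  · -- `Φ (7R) = 0`
    have hmk : (QuotientGroup.mk (rep (Κ (κ ((7 : ℕ) • R)))) : ℚˣ ⧸ (powMonoidHom 7 : ℚˣ →* ℚˣ).range) =
        QuotientGroup.mk 1 := by
      apply Additive.ofMul.injective
      rw [← hrep, hκ7, map_zero, QuotientGroup.mk_one, ofMul_one]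
    ext q
    haveI : Fact (q : ℕ).Prime := ⟨Nat.prime_of_mem_primeFactors q.2⟩
    change ((padicValRat q (rep (Κ (κ ((7 : ℕ) • R))) : ℚ) : ℤ) : ZMod 7) = 0
    rw [padicValRat_cast_eq_of_mk_eq hmk q, Units.val_one, padicValRat.one, Int.cast_zero]
  · -- the value formula, via the descent identity `a · u⁷ · f_T(7P₁) = f_T(P)`
    obtain ⟨x₀, y₀, h₀', e₅, hT₅, he₀⟩ := exists_seven_zsmul_eq m n P₁ hP₁ h49
    have hQ₀0 : ((7 : ℕ) : ℤ) • P₁ ≠ 0 := by rw [e₅]; exact Affine.Point.some_ne_zero _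
    have hQ₀T : ((7 : ℕ) : ℤ) • P₁ ≠ T₀ := by
      rw [e₅, hT₀, Tbar_eq]
      intro hh
      have hh' := Affine.Point.some.inj hh
      exact hT₅ ⟨by simpa using hh'.1, by simpa using hh'.2⟩
    have ha₀ : (kubertTateSeven (m : ℚ) (n : ℚ)).HasValueAt (kummerFn₇ (m : ℚ) (n : ℚ)) (((7 : ℕ) : ℤ) • P₁)
        (algebraMap ℚ (AlgebraicClosure ℚ) (x₀ ^ 2 * y₀ - n * (m + n) * x₀ ^ 3 + (n : ℚ) ^ 3 * (2 * m + n) * x₀ * y₀ - m ^ 2 * (n : ℚ) ^ 4 * x₀ ^ 2 + m ^ 2 * (n : ℚ) ^ 6 * y₀)) := by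
      rw [e₅]
      refine (hasValueAt_kummerFn₇ (m : ℚ) (n : ℚ) h₀').congr rfl ?_
      simp only [map_sub, map_add, map_mul, map_pow, map_intCast, map_ofNat]
    have hF₀ := kummerValue_ne_zero m n he₀ hT₅
    -- the valuation of (a representative of) `Κ (κ P)` for an affine rational point `P ≠ T`
    have key : ∀ (x y : ℚ) (h : (kubertTateSeven (m : ℚ) (n : ℚ)).toAffine.Nonsingular x y), ¬ (x = 0 ∧ y = 0) →
        ∀ q : ℕ, [Fact q.Prime] → ((padicValRat q (rep (Κ (κ (.some x y h))) : ℚ) : ℤ) : ZMod 7) =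
          ((padicValRat q (x ^ 2 * y - n * (m + n) * x ^ 3 + (n : ℚ) ^ 3 * (2 * m + n) * x * y - m ^ 2 * (n : ℚ) ^ 4 * x ^ 2 + m ^ 2 * (n : ℚ) ^ 6 * y) -
            padicValRat q (x₀ ^ 2 * y₀ - n * (m + n) * x₀ ^ 3 + (n : ℚ) ^ 3 * (2 * m + n) * x₀ * y₀ - m ^ 2 * (n : ℚ) ^ 4 * x₀ ^ 2 + m ^ 2 * (n : ℚ) ^ 6 * y₀) : ℤ) : ZMod 7) := by
      intro x y h hxy q _
      obtain ⟨c, Q', hκP, hc, hψQ'⟩ := hκ (.some x y h)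
      obtain ⟨h₁, e₁⟩ := KubertTateSevenTorsion.toGeomPoints_some m n h
      have hP0 : ψ Q' ≠ 0 := by rw [hψQ', e₁]; exact Affine.Point.some_ne_zero _
      have hPT : ψ Q' ≠ T₀ := by
        rw [hψQ', e₁, hT₀, Tbar_eq]
        intro hh
        have hh' := Affine.Point.some.inj hh
        exact hxy ⟨by simpa using hh'.1, by simpa using hh'.2⟩
      have hb : (kubertTateSeven (m : ℚ) (n : ℚ)).HasValueAt (kummerFn₇ (m : ℚ) (n : ℚ)) (ψ Q')
          (algebraMap ℚ (AlgebraicClosure ℚ) (x ^ 2 * y - n * (m + n) * x ^ 3 + (n : ℚ) ^ 3 * (2 * m + n) * x * y - m ^ 2 * (n : ℚ) ^ 4 * x ^ 2 + m ^ 2 * (n : ℚ) ^ 6 * y)) := by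
        rw [hψQ', e₁]
        refine (hasValueAt_kummerFn₇ (m : ℚ) (n : ℚ) h₁).congr rfl ?_
        simp only [map_sub, map_add, map_mul, map_pow, map_intCast, map_ofNat]
      obtain ⟨α, a, hαp, hcα⟩ := exists_root_of_cocycle (sevenIsogeny (m : ℚ) (n : ℚ)) ψ hψ T₀ hT hTfix hker c
      have hinv := kummerInvariant_oneCocycleClass_eq_of_root (sevenIsogeny (m : ℚ) (n : ℚ)) ψ hψ T₀ hT hTfix hker
        c hαp hcα
      -- `rep (Κ (κ P)) ≡ a (mod ℚˣ⁷)`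
      have hmk : (QuotientGroup.mk (rep (Κ (κ (.some x y h)))) : ℚˣ ⧸ (powMonoidHom 7 : ℚˣ →* ℚˣ).range) =
          QuotientGroup.mk a := by
        apply Additive.ofMul.injective
        rw [← hrep, hκP, hΚ, hinv]
      rw [padicValRat_cast_eq_of_mk_eq hmk q]
      -- the descent identity in `ℚ`: `a · u⁷ · f₀ = f(P)`
      obtain ⟨u, hu0, hu⟩ := exists_mul_pow_eq_value_of_coboundary (sevenIsogeny (m : ℚ) (n : ℚ)) ψ hψ T₀ hT hTfix
        hker (kummerFn₇_ne_zero (m : ℚ) (n : ℚ)) (ord_kummerFn₇ (m : ℚ) (n : ℚ)) c hc hP0 hPT hb hQ₀0 hQ₀T hP₁ ha₀ hαp hcα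
      rw [← map_mul] at hu
      have hu' := (algebraMap ℚ (AlgebraicClosure ℚ)).injective hu
      have hv := congrArg (padicValRat q) hu'
      rw [padicValRat.mul (mul_ne_zero a.ne_zero (pow_ne_zero _ hu0)) hF₀,
        padicValRat.mul a.ne_zero (pow_ne_zero _ hu0), padicValRat.pow] at hv
      rw [ZMod.intCast_eq_intCast_iff_dvd_sub]
      exact ⟨padicValRat q u, by linarith⟩
    ext q
    haveI : Fact (q : ℕ).Prime := ⟨Nat.prime_of_mem_primeFactors q.2⟩
    change ((padicValRat q (rep (Κ (κ (.some x y h))) : ℚ) : ℤ) : ZMod 7) -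
        ((padicValRat q (rep (Κ (κ (.some x' y' h'))) : ℚ) : ℤ) : ZMod 7) = _
    rw [key x y h hxy q, key x' y' h' hxy' q]
    push_cast
    ring

/-! ## §3 The box-filling criterion and the complete descent -/

/-- `E(ℚ)/7E(ℚ)` is finite (Mordell–Weil; `#(E(ℚ)/7E(ℚ)) = 7^rank · #E(ℚ)[7]`). [cite: SilvermanAEC2009, Thm. VIII.6.7] -/
theorem finite_quotient_seven :
    Finite ((kubertTateSeven (m : ℚ) (n : ℚ)).toAffine.Point ⧸ (nsmulAddMonoidHom (7 : ℕ) :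
      (kubertTateSeven (m : ℚ) (n : ℚ)).toAffine.Point →+ (kubertTateSeven (m : ℚ) (n : ℚ)).toAffine.Point).range) := by
  haveI : Module.Finite ℤ (kubertTateSeven (m : ℚ) (n : ℚ)).toAffine.Point := by
    convert module_finite_point_holds (kubertTateSeven (m : ℚ) (n : ℚ))
  haveI : Finite (AddSubgroup.torsionBy (kubertTateSeven (m : ℚ) (n : ℚ)).toAffine.Point ((7 : ℕ) : ℤ)) :=
    Literature.NumberTheory.EllipticCurves.finite_torsionBy_of_injective
      (toGeomPoints (kubertTateSeven (m : ℚ) (n : ℚ))) (toGeomPoints_injective _) _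
      (WeierstrassCurve.finite_torsionBy_of_isAlgClosed
        (V := (kubertTateSeven (m : ℚ) (n : ℚ)).baseChange (AlgebraicClosure ℚ)) (by norm_num))
  have hcard := natCard_quotient_nsmulRange_eq (kubertTateSeven (m : ℚ) (n : ℚ)).toAffine.Point 7
  apply Nat.finite_of_card_ne_zero
  rw [hcard]
  exact mul_ne_zero (pow_ne_zero _ (by norm_num)) Nat.card_pos.ne'

include hP₁ h49 in
/-- **The box-filling criterion.** If rational affine points `P_i = (x_i, y_i) ≠ T` (`i ∈ ι`) and a base point
`P' = (x', y') ≠ T` of `E_{m,n}` have difference vectors `(v_q f_T(P_i) − v_q f_T(P'))_{q ∣ mn(m−n)} mod 7` that SPAN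
`(ℤ/7)^S`, then **`7 ^ ω(mn(m−n)) ≤ #(E(ℚ)/7E(ℚ))`** (the valuation homomorphism `Φ` of `exists_valHom` factors through
`E(ℚ)/7E(ℚ)` and is onto). [cite: SilvermanAEC2009, Thm. X.1.1 and Exercise 10.1(c)] [cite: Fisher2001FiveSevenDescent, §2] -/
theorem pow_card_le_natCard_quotient_of_span {ι : Type*} [Fintype ι]
    (x y : ι → ℚ) (hns : ∀ i, (kubertTateSeven (m : ℚ) (n : ℚ)).toAffine.Nonsingular (x i) (y i))
    (hxy : ∀ i, ¬ (x i = 0 ∧ y i = 0))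
    (x' y' : ℚ) (hns' : (kubertTateSeven (m : ℚ) (n : ℚ)).toAffine.Nonsingular x' y') (hxy' : ¬ (x' = 0 ∧ y' = 0))
    (hspan : ∀ e : ↥(m * n * (m - n)).natAbs.primeFactors → ZMod 7, ∃ c : ι → ℕ,
      e = ∑ i, c i • fun q : ↥(m * n * (m - n)).natAbs.primeFactors ↦
        ((padicValRat q (x i ^ 2 * y i - n * (m + n) * x i ^ 3 + (n : ℚ) ^ 3 * (2 * m + n) * x i * y i - m ^ 2 * (n : ℚ) ^ 4 * x i ^ 2 + m ^ 2 * (n : ℚ) ^ 6 * y i) -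
          padicValRat q (x' ^ 2 * y' - n * (m + n) * x' ^ 3 + (n : ℚ) ^ 3 * (2 * m + n) * x' * y' - m ^ 2 * (n : ℚ) ^ 4 * x' ^ 2 + m ^ 2 * (n : ℚ) ^ 6 * y') : ℤ) : ZMod 7)) :
    7 ^ (m * n * (m - n)).natAbs.primeFactors.card ≤
      Nat.card ((kubertTateSeven (m : ℚ) (n : ℚ)).toAffine.Point ⧸ (nsmulAddMonoidHom (7 : ℕ) :
        (kubertTateSeven (m : ℚ) (n : ℚ)).toAffine.Point →+ (kubertTateSeven (m : ℚ) (n : ℚ)).toAffine.Point).range) := by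
  obtain ⟨ψ, hψ⟩ := exists_dual m n
  obtain ⟨Φ, hΦ7, hΦ⟩ := exists_valHom m n ψ hψ P₁ hP₁ h49
  set N := (nsmulAddMonoidHom (7 : ℕ) :
    (kubertTateSeven (m : ℚ) (n : ℚ)).toAffine.Point →+ (kubertTateSeven (m : ℚ) (n : ℚ)).toAffine.Point).range with hN
  have hNker : N ≤ Φ.ker := by
    rintro _ ⟨R, rfl⟩
    rw [AddMonoidHom.mem_ker, nsmulAddMonoidHom_apply, hΦ7]
  set Φbar := QuotientAddGroup.lift N Φ hNker with hΦbar
  have hsurj : Function.Surjective Φbar := by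
    intro e
    obtain ⟨c, hc⟩ := hspan e
    refine ⟨QuotientAddGroup.mk (∑ i, c i • (Affine.Point.some (x i) (y i) (hns i) - .some x' y' hns')), ?_⟩
    rw [hΦbar, QuotientAddGroup.lift_mk, map_sum, hc]
    refine Finset.sum_congr rfl fun i _ ↦ ?_
    rw [map_nsmul, map_sub, hΦ (x i) (y i) (hns i) (hxy i) x' y' hns' hxy']
  haveI := finite_quotient_seven m n
  have hle := Nat.card_le_card_of_surjective Φbar hsurj
  have hfun : Nat.card (↥(m * n * (m - n)).natAbs.primeFactors → ZMod 7) = 7 ^ (m * n * (m - n)).natAbs.primeFactors.card := by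
    rw [Nat.card_fun, Nat.card_eq_fintype_card (α := ZMod 7), ZMod.card, Nat.card_eq_fintype_card,
      Fintype.card_coe]
  rw [hfun] at hle
  exact hle

include hP₁ h49 in
/-- **The box-filling criterion, matrix form (what an instance checks by `decide`).** Enumerate the primes of
`mn` as `q₀, …, q_{k−1}`, take `k` rational affine points `P_i ≠ T` and a base point `P' ≠ T`, and let
`M_{ij} = v_{q_j} f_T(P_i) − v_{q_j} f_T(P') mod 7`. If `c ↦ c M` is onto `(ℤ/7)^k` (e.g. `M` has a
left inverse `M'` mod `7`: `c = e M'`, which an instance checks by `decide`) then `7 ^ ω(mn(m−n)) ≤ #(E(ℚ)/7E(ℚ))`. [cite: SilvermanAEC2009, Thm. X.1.1 and Exercise 10.1(c)] [cite: Fisher2001FiveSevenDescent, §2] -/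
theorem pow_card_le_natCard_quotient_of_matrix {k : ℕ} (q : Fin k → ℕ)
    (hqS : ∀ j, q j ∈ (m * n * (m - n)).natAbs.primeFactors) (hqsurj : ∀ p ∈ (m * n * (m - n)).natAbs.primeFactors, ∃ j, q j = p)
    (x y : Fin k → ℚ) (hns : ∀ i, (kubertTateSeven (m : ℚ) (n : ℚ)).toAffine.Nonsingular (x i) (y i))
    (hxy : ∀ i, ¬ (x i = 0 ∧ y i = 0))
    (x' y' : ℚ) (hns' : (kubertTateSeven (m : ℚ) (n : ℚ)).toAffine.Nonsingular x' y') (hxy' : ¬ (x' = 0 ∧ y' = 0))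
    (hM : ∀ e : Fin k → ZMod 7, ∃ c : Fin k → ZMod 7, Matrix.vecMul c (Matrix.of (fun i j : Fin k ↦
      ((padicValRat (q j) (x i ^ 2 * y i - n * (m + n) * x i ^ 3 + (n : ℚ) ^ 3 * (2 * m + n) * x i * y i - m ^ 2 * (n : ℚ) ^ 4 * x i ^ 2 + m ^ 2 * (n : ℚ) ^ 6 * y i) -
        padicValRat (q j) (x' ^ 2 * y' - n * (m + n) * x' ^ 3 + (n : ℚ) ^ 3 * (2 * m + n) * x' * y' - m ^ 2 * (n : ℚ) ^ 4 * x' ^ 2 + m ^ 2 * (n : ℚ) ^ 6 * y') : ℤ) : ZMod 7))) = e) :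
    7 ^ (m * n * (m - n)).natAbs.primeFactors.card ≤
      Nat.card ((kubertTateSeven (m : ℚ) (n : ℚ)).toAffine.Point ⧸ (nsmulAddMonoidHom (7 : ℕ) :
        (kubertTateSeven (m : ℚ) (n : ℚ)).toAffine.Point →+ (kubertTateSeven (m : ℚ) (n : ℚ)).toAffine.Point).range) := by
  set M : Matrix (Fin k) (Fin k) (ZMod 7) := Matrix.of (fun i j : Fin k ↦
      ((padicValRat (q j) (x i ^ 2 * y i - n * (m + n) * x i ^ 3 + (n : ℚ) ^ 3 * (2 * m + n) * x i * y i - m ^ 2 * (n : ℚ) ^ 4 * x i ^ 2 + m ^ 2 * (n : ℚ) ^ 6 * y i) -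
        padicValRat (q j) (x' ^ 2 * y' - n * (m + n) * x' ^ 3 + (n : ℚ) ^ 3 * (2 * m + n) * x' * y' - m ^ 2 * (n : ℚ) ^ 4 * x' ^ 2 + m ^ 2 * (n : ℚ) ^ 6 * y') : ℤ) : ZMod 7)) with hMdef
  apply pow_card_le_natCard_quotient_of_span m n P₁ hP₁ h49 x y hns hxy x' y' hns' hxy'
  intro e
  -- `c M = e'` with `e'_j = e(q_j)` (a left inverse of `M` mod `7` supplies `c = e' M⁻¹`)
  set e' : Fin k → ZMod 7 := fun j ↦ e ⟨q j, hqS j⟩ with he'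
  obtain ⟨cvec, hcM⟩ := hM e'
  refine ⟨fun i ↦ (cvec i).val, ?_⟩
  funext p
  obtain ⟨j, hj⟩ := hqsurj p.1 p.2
  have hp : p = ⟨q j, hqS j⟩ := Subtype.ext hj.symm
  subst hp
  have hj' := congrFun hcM j
  rw [Matrix.vecMul, dotProduct] at hj'
  rw [Finset.sum_apply]
  simp only [Pi.smul_apply, nsmul_eq_mul, ZMod.natCast_zmod_val]
  change e' j = _
  rw [← hj']
  exact Finset.sum_congr rfl fun i _ ↦ rfl

variable (h7 : ¬ (7 : ℤ) ∣ (kubertTateSeven m n).Δ)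
  (h1 : ∀ p : ℕ, p.Prime → (p : ℤ) ∣ (kubertTateSeven m n).Δ → p % 7 ≠ 1)

include hP₁ h49 h7 h1 in
/-- **`t₇(E_{m,n}) = 0` from points**: in the tame régime, `ω(mn(m−n))` rational points whose `f_T`-valuation vectors
(relative to a base point) span `(ℤ/7)^S` give `Ш(E_{m,n}/ℚ)[7^∞]` finite, indeed `t₇ = 0` — the complete
`7`-descent, by descent alone. [cite: SilvermanAEC2009, Thm. X.4.2(a)] [cite: Fisher2001FiveSevenDescent, §2] -/
theorem shaCorank_seven_eq_zero_of_span {ι : Type*} [Fintype ι]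
    (x y : ι → ℚ) (hns : ∀ i, (kubertTateSeven (m : ℚ) (n : ℚ)).toAffine.Nonsingular (x i) (y i))
    (hxy : ∀ i, ¬ (x i = 0 ∧ y i = 0))
    (x' y' : ℚ) (hns' : (kubertTateSeven (m : ℚ) (n : ℚ)).toAffine.Nonsingular x' y') (hxy' : ¬ (x' = 0 ∧ y' = 0))
    (hspan : ∀ e : ↥(m * n * (m - n)).natAbs.primeFactors → ZMod 7, ∃ c : ι → ℕ,
      e = ∑ i, c i • fun q : ↥(m * n * (m - n)).natAbs.primeFactors ↦
        ((padicValRat q (x i ^ 2 * y i - n * (m + n) * x i ^ 3 + (n : ℚ) ^ 3 * (2 * m + n) * x i * y i - m ^ 2 * (n : ℚ) ^ 4 * x i ^ 2 + m ^ 2 * (n : ℚ) ^ 6 * y i) -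
          padicValRat q (x' ^ 2 * y' - n * (m + n) * x' ^ 3 + (n : ℚ) ^ 3 * (2 * m + n) * x' * y' - m ^ 2 * (n : ℚ) ^ 4 * x' ^ 2 + m ^ 2 * (n : ℚ) ^ 6 * y') : ℤ) : ZMod 7)) :
    (kubertTateSeven (m : ℚ) (n : ℚ)).shaCorank 7 = 0 :=
  shaCorank_seven_eq_zero_of_le m n P₁ hP₁ h49 h7 h1
    (pow_card_le_natCard_quotient_of_span m n P₁ hP₁ h49 x y hns hxy x' y' hns' hxy' hspan)

include hP₁ h49 h7 h1 in
/-- **`Ш(E_{m,n}/ℚ)[7] = 0` from points** (tame régime, box full). [cite: SilvermanAEC2009, Thm. X.4.2(a)] -/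
theorem sha_torsionBy_seven_eq_bot_of_span {ι : Type*} [Fintype ι]
    (x y : ι → ℚ) (hns : ∀ i, (kubertTateSeven (m : ℚ) (n : ℚ)).toAffine.Nonsingular (x i) (y i))
    (hxy : ∀ i, ¬ (x i = 0 ∧ y i = 0))
    (x' y' : ℚ) (hns' : (kubertTateSeven (m : ℚ) (n : ℚ)).toAffine.Nonsingular x' y') (hxy' : ¬ (x' = 0 ∧ y' = 0))
    (hspan : ∀ e : ↥(m * n * (m - n)).natAbs.primeFactors → ZMod 7, ∃ c : ι → ℕ,
      e = ∑ i, c i • fun q : ↥(m * n * (m - n)).natAbs.primeFactors ↦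
        ((padicValRat q (x i ^ 2 * y i - n * (m + n) * x i ^ 3 + (n : ℚ) ^ 3 * (2 * m + n) * x i * y i - m ^ 2 * (n : ℚ) ^ 4 * x i ^ 2 + m ^ 2 * (n : ℚ) ^ 6 * y i) -
          padicValRat q (x' ^ 2 * y' - n * (m + n) * x' ^ 3 + (n : ℚ) ^ 3 * (2 * m + n) * x' * y' - m ^ 2 * (n : ℚ) ^ 4 * x' ^ 2 + m ^ 2 * (n : ℚ) ^ 6 * y') : ℤ) : ZMod 7)) :
    (kubertTateSeven (m : ℚ) (n : ℚ)).sha[((7 : ℕ) : ℤ)] = ⊥ :=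
  sha_torsionBy_seven_eq_bot_of_le m n P₁ hP₁ h49 h7 h1
    (pow_card_le_natCard_quotient_of_span m n P₁ hP₁ h49 x y hns hxy x' y' hns' hxy' hspan)

include hP₁ h49 h7 h1 in
/-- **`rank E_{m,n}(ℚ) + 1 = ω(mn(m−n))` from points** (tame régime, box full): the `7`-descent computes the rank.
[cite: SilvermanAEC2009, Thm. X.4.2 and Thm. X.1.1] -/
theorem mordellWeilRank_succ_eq_of_span {ι : Type*} [Fintype ι]
    (x y : ι → ℚ) (hns : ∀ i, (kubertTateSeven (m : ℚ) (n : ℚ)).toAffine.Nonsingular (x i) (y i))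
    (hxy : ∀ i, ¬ (x i = 0 ∧ y i = 0))
    (x' y' : ℚ) (hns' : (kubertTateSeven (m : ℚ) (n : ℚ)).toAffine.Nonsingular x' y') (hxy' : ¬ (x' = 0 ∧ y' = 0))
    (hspan : ∀ e : ↥(m * n * (m - n)).natAbs.primeFactors → ZMod 7, ∃ c : ι → ℕ,
      e = ∑ i, c i • fun q : ↥(m * n * (m - n)).natAbs.primeFactors ↦
        ((padicValRat q (x i ^ 2 * y i - n * (m + n) * x i ^ 3 + (n : ℚ) ^ 3 * (2 * m + n) * x i * y i - m ^ 2 * (n : ℚ) ^ 4 * x i ^ 2 + m ^ 2 * (n : ℚ) ^ 6 * y i) -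
          padicValRat q (x' ^ 2 * y' - n * (m + n) * x' ^ 3 + (n : ℚ) ^ 3 * (2 * m + n) * x' * y' - m ^ 2 * (n : ℚ) ^ 4 * x' ^ 2 + m ^ 2 * (n : ℚ) ^ 6 * y') : ℤ) : ZMod 7))
    (h7tors : Nat.card (AddSubgroup.torsionBy (kubertTateSeven (m : ℚ) (n : ℚ)).toAffine.Point ((7 : ℕ) : ℤ)) = 7) :
    (kubertTateSeven (m : ℚ) (n : ℚ)).mordellWeilRank + 1 = (m * n * (m - n)).natAbs.primeFactors.card := by
  obtain ⟨ψ, hψ⟩ := exists_dual m n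
  have hbox := pow_card_le_natCard_quotient_of_span m n P₁ hP₁ h49 x y hns hxy x' y' hns' hxy' hspan
  have heq := natCard_quotient_eq_of_le m n P₁ hP₁ h49 h7 h1 hbox
  haveI : Module.Finite ℤ (kubertTateSeven (m : ℚ) (n : ℚ)).toAffine.Point := by
    convert module_finite_point_holds (kubertTateSeven (m : ℚ) (n : ℚ))
  rw [natCard_quotient_nsmulRange_eq, h7tors, ← pow_succ] at heq
  have hr : (kubertTateSeven (m : ℚ) (n : ℚ)).mordellWeilRank =
      Module.finrank ℤ (kubertTateSeven (m : ℚ) (n : ℚ)).toAffine.Point := by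
    unfold WeierstrassCurve.mordellWeilRank; congr!
  rw [hr]
  exact Nat.pow_right_injective (le_refl 2) (by simpa using heq)

/-! ## §4 Matrix forms (what an instance file applies: no `E(ℚ)`-group statement is left to the instance) -/

include hP₁ h49 h7 h1 in
/-- **`t₇(E_{m,n}) = 0` from `ω(mn(m−n))` points and a left-inverse matrix mod `7`** (tame régime; the box
criterion `pow_card_le_natCard_quotient_of_matrix` fed into `shaCorank_seven_eq_zero_of_le`).
[cite: SilvermanAEC2009, Thm. X.4.2(a)] [cite: Fisher2001FiveSevenDescent, §2] -/
theorem shaCorank_seven_eq_zero_of_matrix {k : ℕ} (q : Fin k → ℕ)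
    (hqS : ∀ j, q j ∈ (m * n * (m - n)).natAbs.primeFactors) (hqsurj : ∀ p ∈ (m * n * (m - n)).natAbs.primeFactors, ∃ j, q j = p)
    (x y : Fin k → ℚ) (hns : ∀ i, (kubertTateSeven (m : ℚ) (n : ℚ)).toAffine.Nonsingular (x i) (y i))
    (hxy : ∀ i, ¬ (x i = 0 ∧ y i = 0))
    (x' y' : ℚ) (hns' : (kubertTateSeven (m : ℚ) (n : ℚ)).toAffine.Nonsingular x' y') (hxy' : ¬ (x' = 0 ∧ y' = 0))
    (hM : ∀ e : Fin k → ZMod 7, ∃ c : Fin k → ZMod 7, Matrix.vecMul c (Matrix.of (fun i j : Fin k ↦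
      ((padicValRat (q j) (x i ^ 2 * y i - n * (m + n) * x i ^ 3 + (n : ℚ) ^ 3 * (2 * m + n) * x i * y i - m ^ 2 * (n : ℚ) ^ 4 * x i ^ 2 + m ^ 2 * (n : ℚ) ^ 6 * y i) -
        padicValRat (q j) (x' ^ 2 * y' - n * (m + n) * x' ^ 3 + (n : ℚ) ^ 3 * (2 * m + n) * x' * y' - m ^ 2 * (n : ℚ) ^ 4 * x' ^ 2 + m ^ 2 * (n : ℚ) ^ 6 * y') : ℤ) : ZMod 7))) = e) :
    (kubertTateSeven (m : ℚ) (n : ℚ)).shaCorank 7 = 0 :=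
  shaCorank_seven_eq_zero_of_le m n P₁ hP₁ h49 h7 h1
    (pow_card_le_natCard_quotient_of_matrix m n P₁ hP₁ h49 q hqS hqsurj x y hns hxy x' y' hns' hxy' hM)

include hP₁ h49 h7 h1 in
/-- **`Ш(E_{m,n}/ℚ)[7] = 0` from `ω(mn(m−n))` points and a left-inverse matrix mod `7`** (tame régime).
[cite: SilvermanAEC2009, Thm. X.4.2(a)] -/
theorem sha_torsionBy_seven_eq_bot_of_matrix {k : ℕ} (q : Fin k → ℕ)
    (hqS : ∀ j, q j ∈ (m * n * (m - n)).natAbs.primeFactors) (hqsurj : ∀ p ∈ (m * n * (m - n)).natAbs.primeFactors, ∃ j, q j = p)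
    (x y : Fin k → ℚ) (hns : ∀ i, (kubertTateSeven (m : ℚ) (n : ℚ)).toAffine.Nonsingular (x i) (y i))
    (hxy : ∀ i, ¬ (x i = 0 ∧ y i = 0))
    (x' y' : ℚ) (hns' : (kubertTateSeven (m : ℚ) (n : ℚ)).toAffine.Nonsingular x' y') (hxy' : ¬ (x' = 0 ∧ y' = 0))
    (hM : ∀ e : Fin k → ZMod 7, ∃ c : Fin k → ZMod 7, Matrix.vecMul c (Matrix.of (fun i j : Fin k ↦
      ((padicValRat (q j) (x i ^ 2 * y i - n * (m + n) * x i ^ 3 + (n : ℚ) ^ 3 * (2 * m + n) * x i * y i - m ^ 2 * (n : ℚ) ^ 4 * x i ^ 2 + m ^ 2 * (n : ℚ) ^ 6 * y i) -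
        padicValRat (q j) (x' ^ 2 * y' - n * (m + n) * x' ^ 3 + (n : ℚ) ^ 3 * (2 * m + n) * x' * y' - m ^ 2 * (n : ℚ) ^ 4 * x' ^ 2 + m ^ 2 * (n : ℚ) ^ 6 * y') : ℤ) : ZMod 7))) = e) :
    (kubertTateSeven (m : ℚ) (n : ℚ)).sha[((7 : ℕ) : ℤ)] = ⊥ :=
  sha_torsionBy_seven_eq_bot_of_le m n P₁ hP₁ h49 h7 h1
    (pow_card_le_natCard_quotient_of_matrix m n P₁ hP₁ h49 q hqS hqsurj x y hns hxy x' y' hns' hxy' hM)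

include hP₁ h49 h7 h1 in
/-- **`Ш(E_{m,n}/ℚ)[7^∞] = 0` from `ω(mn(m−n))` points and a left-inverse matrix mod `7`** (tame régime).
[cite: SilvermanAEC2009, Thm. X.4.2(a)] -/
theorem primaryComponent_sha_seven_eq_bot_of_matrix {k : ℕ} (q : Fin k → ℕ)
    (hqS : ∀ j, q j ∈ (m * n * (m - n)).natAbs.primeFactors) (hqsurj : ∀ p ∈ (m * n * (m - n)).natAbs.primeFactors, ∃ j, q j = p)
    (x y : Fin k → ℚ) (hns : ∀ i, (kubertTateSeven (m : ℚ) (n : ℚ)).toAffine.Nonsingular (x i) (y i))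
    (hxy : ∀ i, ¬ (x i = 0 ∧ y i = 0))
    (x' y' : ℚ) (hns' : (kubertTateSeven (m : ℚ) (n : ℚ)).toAffine.Nonsingular x' y') (hxy' : ¬ (x' = 0 ∧ y' = 0))
    (hM : ∀ e : Fin k → ZMod 7, ∃ c : Fin k → ZMod 7, Matrix.vecMul c (Matrix.of (fun i j : Fin k ↦
      ((padicValRat (q j) (x i ^ 2 * y i - n * (m + n) * x i ^ 3 + (n : ℚ) ^ 3 * (2 * m + n) * x i * y i - m ^ 2 * (n : ℚ) ^ 4 * x i ^ 2 + m ^ 2 * (n : ℚ) ^ 6 * y i) -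
        padicValRat (q j) (x' ^ 2 * y' - n * (m + n) * x' ^ 3 + (n : ℚ) ^ 3 * (2 * m + n) * x' * y' - m ^ 2 * (n : ℚ) ^ 4 * x' ^ 2 + m ^ 2 * (n : ℚ) ^ 6 * y') : ℤ) : ZMod 7))) = e) :
    AddCommGroup.primaryComponent (kubertTateSeven (m : ℚ) (n : ℚ)).sha 7 = ⊥ :=
  primaryComponent_sha_seven_eq_bot_of_le m n P₁ hP₁ h49 h7 h1
    (pow_card_le_natCard_quotient_of_matrix m n P₁ hP₁ h49 q hqS hqsurj x y hns hxy x' y' hns' hxy' hM)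

include hP₁ h49 h7 h1 in
/-- **`rank E_{m,n}(ℚ) + 1 = ω(mn(m−n))` from `ω(mn(m−n))` points and a left-inverse matrix mod `7`** (tame régime,
given `#E(ℚ)[7] = 7`): the `7`-descent computes the rank. [cite: SilvermanAEC2009, Thm. X.4.2 and Thm. X.1.1] -/
theorem mordellWeilRank_succ_eq_of_matrix {k : ℕ} (q : Fin k → ℕ)
    (hqS : ∀ j, q j ∈ (m * n * (m - n)).natAbs.primeFactors) (hqsurj : ∀ p ∈ (m * n * (m - n)).natAbs.primeFactors, ∃ j, q j = p)
    (x y : Fin k → ℚ) (hns : ∀ i, (kubertTateSeven (m : ℚ) (n : ℚ)).toAffine.Nonsingular (x i) (y i))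
    (hxy : ∀ i, ¬ (x i = 0 ∧ y i = 0))
    (x' y' : ℚ) (hns' : (kubertTateSeven (m : ℚ) (n : ℚ)).toAffine.Nonsingular x' y') (hxy' : ¬ (x' = 0 ∧ y' = 0))
    (hM : ∀ e : Fin k → ZMod 7, ∃ c : Fin k → ZMod 7, Matrix.vecMul c (Matrix.of (fun i j : Fin k ↦
      ((padicValRat (q j) (x i ^ 2 * y i - n * (m + n) * x i ^ 3 + (n : ℚ) ^ 3 * (2 * m + n) * x i * y i - m ^ 2 * (n : ℚ) ^ 4 * x i ^ 2 + m ^ 2 * (n : ℚ) ^ 6 * y i) -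
        padicValRat (q j) (x' ^ 2 * y' - n * (m + n) * x' ^ 3 + (n : ℚ) ^ 3 * (2 * m + n) * x' * y' - m ^ 2 * (n : ℚ) ^ 4 * x' ^ 2 + m ^ 2 * (n : ℚ) ^ 6 * y') : ℤ) : ZMod 7))) = e)
    (h7tors : Nat.card (AddSubgroup.torsionBy (kubertTateSeven (m : ℚ) (n : ℚ)).toAffine.Point ((7 : ℕ) : ℤ)) = 7) :
    (kubertTateSeven (m : ℚ) (n : ℚ)).mordellWeilRank + 1 = (m * n * (m - n)).natAbs.primeFactors.card := by
  have hbox := pow_card_le_natCard_quotient_of_matrix m n P₁ hP₁ h49 q hqS hqsurj x y hns hxy x' y' hns' hxy' hM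
  have heq := natCard_quotient_eq_of_le m n P₁ hP₁ h49 h7 h1 hbox
  haveI : Module.Finite ℤ (kubertTateSeven (m : ℚ) (n : ℚ)).toAffine.Point := by
    convert module_finite_point_holds (kubertTateSeven (m : ℚ) (n : ℚ))
  rw [natCard_quotient_nsmulRange_eq, h7tors, ← pow_succ] at heq
  have hr : (kubertTateSeven (m : ℚ) (n : ℚ)).mordellWeilRank =
      Module.finrank ℤ (kubertTateSeven (m : ℚ) (n : ℚ)).toAffine.Point := by
    unfold WeierstrassCurve.mordellWeilRank; congr!
  rw [hr]
  exact Nat.pow_right_injective (le_refl 2) (by simpa using heq)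

/-! ## §5 Class-wide form: `t₇ = 0` whenever the rank attains the descent bound -/

include hP₁ h49 h7 h1 in
/-- **Class-wide: in the tame régime, `t₇(E_{m,n}) = 0` as soon as `rank E_{m,n}(ℚ) + 1 ≥ ω(mn(m−n))`** (given
`#E(ℚ)[7] = 7`): then `#(E(ℚ)/7E(ℚ)) = 7^{rank+1} ≥ 7^{ω(mn(m−n))}` fills the box, so `Ш(E'/ℚ)[ψ] = 0` and
`Ш(E_{m,n}/ℚ)[7] = 0`. With `mordellWeilRank_succ_le` (`rank + 1 ≤ ω(mn(m−n))` always), the descent bound is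
attained iff the box is full; no point data enter. [cite: SilvermanAEC2009, Thm. X.4.2(a) and Thm. X.1.1]
[cite: Fisher2001FiveSevenDescent, §2] -/
theorem shaCorank_seven_eq_zero_of_le_mordellWeilRank_succ
    (h7tors : Nat.card (AddSubgroup.torsionBy (kubertTateSeven (m : ℚ) (n : ℚ)).toAffine.Point ((7 : ℕ) : ℤ)) = 7)
    (hr : (m * n * (m - n)).natAbs.primeFactors.card ≤ (kubertTateSeven (m : ℚ) (n : ℚ)).mordellWeilRank + 1) :
    (kubertTateSeven (m : ℚ) (n : ℚ)).shaCorank 7 = 0 := by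
  haveI : Module.Finite ℤ (kubertTateSeven (m : ℚ) (n : ℚ)).toAffine.Point := by
    convert module_finite_point_holds (kubertTateSeven (m : ℚ) (n : ℚ))
  have hr' : (kubertTateSeven (m : ℚ) (n : ℚ)).mordellWeilRank =
      Module.finrank ℤ (kubertTateSeven (m : ℚ) (n : ℚ)).toAffine.Point := by
    unfold WeierstrassCurve.mordellWeilRank; congr!
  refine shaCorank_seven_eq_zero_of_le m n P₁ hP₁ h49 h7 h1 ?_
  rw [natCard_quotient_nsmulRange_eq, h7tors, ← pow_succ, ← hr']
  exact Nat.pow_le_pow_right (by norm_num) hr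

include hP₁ h49 h7 h1 in
/-- **Class-wide: `Ш(E_{m,n}/ℚ)[7] = 0` as soon as `rank E_{m,n}(ℚ) + 1 ≥ ω(mn(m−n))`** (tame régime, `#E(ℚ)[7] = 7`).
[cite: SilvermanAEC2009, Thm. X.4.2(a) and Thm. X.1.1] -/
theorem sha_torsionBy_seven_eq_bot_of_le_mordellWeilRank_succ
    (h7tors : Nat.card (AddSubgroup.torsionBy (kubertTateSeven (m : ℚ) (n : ℚ)).toAffine.Point ((7 : ℕ) : ℤ)) = 7)
    (hr : (m * n * (m - n)).natAbs.primeFactors.card ≤ (kubertTateSeven (m : ℚ) (n : ℚ)).mordellWeilRank + 1) :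
    (kubertTateSeven (m : ℚ) (n : ℚ)).sha[((7 : ℕ) : ℤ)] = ⊥ := by
  haveI : Module.Finite ℤ (kubertTateSeven (m : ℚ) (n : ℚ)).toAffine.Point := by
    convert module_finite_point_holds (kubertTateSeven (m : ℚ) (n : ℚ))
  have hr' : (kubertTateSeven (m : ℚ) (n : ℚ)).mordellWeilRank =
      Module.finrank ℤ (kubertTateSeven (m : ℚ) (n : ℚ)).toAffine.Point := by
    unfold WeierstrassCurve.mordellWeilRank; congr!
  refine sha_torsionBy_seven_eq_bot_of_le m n P₁ hP₁ h49 h7 h1 ?_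
  rw [natCard_quotient_nsmulRange_eq, h7tors, ← pow_succ, ← hr']
  exact Nat.pow_le_pow_right (by norm_num) hr

/-- **The rank decides the box (`#E(ℚ)[7] = 7`)**: `rank E_{m,n}(ℚ) + 1 = ω(mn(m−n))` iff
`#(E(ℚ)/7E(ℚ)) = 7^{ω(mn(m−n))}`; in particular the `μ₇`-box is full exactly when the rank attains Fisher's
descent bound `ω(mn(m−n)) − 1`. [cite: SilvermanAEC2009, Thm. X.4.2 and Thm. X.1.1] [cite: Fisher2001FiveSevenDescent, §2] -/
theorem mordellWeilRank_succ_eq_iff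
    (h7tors : Nat.card (AddSubgroup.torsionBy (kubertTateSeven (m : ℚ) (n : ℚ)).toAffine.Point ((7 : ℕ) : ℤ)) = 7) :
    (kubertTateSeven (m : ℚ) (n : ℚ)).mordellWeilRank + 1 = (m * n * (m - n)).natAbs.primeFactors.card ↔
      Nat.card ((kubertTateSeven (m : ℚ) (n : ℚ)).toAffine.Point ⧸ (nsmulAddMonoidHom (7 : ℕ) :
        (kubertTateSeven (m : ℚ) (n : ℚ)).toAffine.Point →+ (kubertTateSeven (m : ℚ) (n : ℚ)).toAffine.Point).range) =
      7 ^ (m * n * (m - n)).natAbs.primeFactors.card := by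
  haveI : Module.Finite ℤ (kubertTateSeven (m : ℚ) (n : ℚ)).toAffine.Point := by
    convert module_finite_point_holds (kubertTateSeven (m : ℚ) (n : ℚ))
  have hr' : (kubertTateSeven (m : ℚ) (n : ℚ)).mordellWeilRank =
      Module.finrank ℤ (kubertTateSeven (m : ℚ) (n : ℚ)).toAffine.Point := by
    unfold WeierstrassCurve.mordellWeilRank; congr!
  rw [natCard_quotient_nsmulRange_eq, h7tors, ← pow_succ, ← hr']
  constructor
  · intro h; rw [h]
  · intro h; exact Nat.pow_right_injective (show 2 ≤ 7 by norm_num) h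

include hP₁ h49 h7 h1 in
/-- **Class-wide first-descent bound in the tame régime: `#Ш(E_{m,n}/ℚ)[7] · 7^{rank + 1} ≤ 7^{ω(mn(m−n))}`**
(given `#E(ℚ)[7] = 7`). Since `Ш(E)[φ] = 0` (tame, tree `KubertTateSevenVelu`), `#Ш(E)[7] ≤ #Ш(E')[ψ]`
(tree `Isogeny.natCard_sha_torsionBy_le_mul_natCard_ker_shaMap`), and `#(E(ℚ)/7E(ℚ)) · #Ш(E')[ψ] = #Sel^ψ(E'/ℚ) ≤ 7^{ω(mn(m−n))}`
with `#(E(ℚ)/7E(ℚ)) = 7^{rank+1}`. With Cassels–Tate (`#Ш[7] = 7^{t₇ + 2m}`) this is the Selmer-corank bound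
`rank + t₇(E_{m,n}) + 1 ≤ ω(mn(m−n))` for the whole tame family. [cite: SilvermanAEC2009, Thm. X.4.2 and Prop. X.4.9]
[cite: Fisher2001FiveSevenDescent, §2] -/
theorem natCard_sha_torsionBy_seven_mul_pow_le
    (h7tors : Nat.card (AddSubgroup.torsionBy (kubertTateSeven (m : ℚ) (n : ℚ)).toAffine.Point ((7 : ℕ) : ℤ)) = 7) :
    Nat.card ((kubertTateSeven (m : ℚ) (n : ℚ)).sha[((7 : ℕ) : ℤ)]) *
      7 ^ ((kubertTateSeven (m : ℚ) (n : ℚ)).mordellWeilRank + 1) ≤ 7 ^ (m * n * (m - n)).natAbs.primeFactors.card := by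
  obtain ⟨ψ, hψ⟩ := exists_dual m n
  haveI : Finite (shaMap ψ.toAddMonoidHom ψ.equivariant ψ.hasLocalPointsMaps_toAddMonoidHom).ker :=
    (finite_ker_shaMap ψ.toAddMonoidHom ψ.equivariant ψ.hasLocalPointsMaps_toAddMonoidHom
      (sevenIsogeny (m : ℚ) (n : ℚ)).toAddMonoidHom (sevenIsogeny (m : ℚ) (n : ℚ)).equivariant (n := 7) (by norm_num)
      (fun Q ↦ by rw [Isogeny.coe_toAddMonoidHom, Isogeny.coe_toAddMonoidHom, comp_dual_eq m n ψ hψ Q])).to_subtype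
  have hφbot := ConstantKernelDescent.ker_shaMap_eq_bot_of_selmerGroup_eq_bot (sevenIsogeny (m : ℚ) (n : ℚ))
    (KubertTateSevenVelu.selmerGroup_sevenIsogeny_eq_bot m n h7 h1)
  haveI : Finite (shaMap (sevenIsogeny (m : ℚ) (n : ℚ)).toAddMonoidHom (sevenIsogeny (m : ℚ) (n : ℚ)).equivariant
      (sevenIsogeny (m : ℚ) (n : ℚ)).hasLocalPointsMaps_toAddMonoidHom).ker := by
    rw [hφbot]; infer_instance
  have hφ1 : Nat.card (shaMap (sevenIsogeny (m : ℚ) (n : ℚ)).toAddMonoidHom (sevenIsogeny (m : ℚ) (n : ℚ)).equivariant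
      (sevenIsogeny (m : ℚ) (n : ℚ)).hasLocalPointsMaps_toAddMonoidHom).ker = 1 := by
    rw [hφbot, AddSubgroup.card_bot]
  have hsha := natCard_sha_torsionBy_le_mul_natCard_ker_shaMap (sevenIsogeny (m : ℚ) (n : ℚ)) ψ (n := 7) hψ
  rw [hφ1, one_mul] at hsha
  have hsel := natCard_selmerGroup_dual_le m n ψ hψ P₁ hP₁ h49
  rw [natCard_selmerGroup_dual_eq m n ψ hψ h7 h1] at hsel
  haveI : Module.Finite ℤ (kubertTateSeven (m : ℚ) (n : ℚ)).toAffine.Point := by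
    convert module_finite_point_holds (kubertTateSeven (m : ℚ) (n : ℚ))
  have hr' : (kubertTateSeven (m : ℚ) (n : ℚ)).mordellWeilRank =
      Module.finrank ℤ (kubertTateSeven (m : ℚ) (n : ℚ)).toAffine.Point := by
    unfold WeierstrassCurve.mordellWeilRank; congr!
  rw [natCard_quotient_nsmulRange_eq, h7tors, ← pow_succ, ← hr'] at hsel
  calc Nat.card ((kubertTateSeven (m : ℚ) (n : ℚ)).sha[((7 : ℕ) : ℤ)]) *
        7 ^ ((kubertTateSeven (m : ℚ) (n : ℚ)).mordellWeilRank + 1)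
      ≤ Nat.card (shaMap ψ.toAddMonoidHom ψ.equivariant ψ.hasLocalPointsMaps_toAddMonoidHom).ker *
        7 ^ ((kubertTateSeven (m : ℚ) (n : ℚ)).mordellWeilRank + 1) := Nat.mul_le_mul_right _ hsha
    _ ≤ 7 ^ (m * n * (m - n)).natAbs.primeFactors.card := by rw [mul_comm]; exact hsel

end Hom

end KubertTateSevenMuDescent

end Literature.NumberTheory.EllipticCurves

end
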